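import Literature.Computability.MetaComplexity.EFModMulUShift
import HarnessLib

/-!
# The unit law of uniform modular multiplication: a one-hot multiplicand

Layer E/5 (uniform variant). `ModMulU.One.isBlock_lines`: for an available multiplier `V`
(`ModMulU.mulT`) whose multiplicand is the one-hot word `u = (c, z, …, z)` (`z` the zero gate)
and whose multiplier is `a < n`, every partial product is the mask of a shift of `a`:
`P_t ≡ c ∧ (a >> (L - t))` bitwise, hence `P_L ≡ c ∧ a` — in particular `1 ⊗ a = a`.

The induction uses, per stage: the doubling rules (the sum bits of `P_t ⊕ P_t` are the shifted
bits), domination (`ModMulU.Shift.monoLines`: the shifted words are `< n`, so no modular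
reduction happens), the masks (only bit `0` can be set), and the disjoint sum
(`ModMulU.Shift.dorLines`). The facts `a >> s < n` come from a chain of shift kits
(`ModMulU.Shift.shiftT`), the kit `ModMulU.One.oneT`.

## Sources

* S. A. Cook, R. A. Reckhow, *The relative efficiency of propositional proof systems*,
  J. Symbolic Logic 44 (1979), §2.
* H. Vollmer, *Introduction to Circuit Complexity* (Springer 1999), §1.2.
-/

namespace Literature.Computability.MetaComplexity

open _root_.Computability Complexity Complexity.PropForm Netlist Cluster FregeSystem

namespace ModMulU

namespace One

/-! ### Rules -/

/-- `¬p`, `¬x` give `p ↔ c ∧ x`. [cite: CookReckhow1979, §2 (sound rule)] -/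
def rMaskFF : FregeRule := ⟨[ctx (var 0) (neg (var 1)), ctx (var 0) (neg (var 3))], ctx (var 0) (biimp (var 1) (conj (var 2) (var 3)))⟩
/-- `s ↔ k`, `k ↔ p`, `p ↔ c ∧ x` give `s ↔ c ∧ x`. [cite: CookReckhow1979, §2 (sound rule)] -/
def rChainMask : FregeRule :=
  ⟨[ctx (var 0) (biimp (var 1) (var 2)), ctx (var 0) (biimp (var 2) (var 3)), ctx (var 0) (biimp (var 3) (conj (var 4) (var 5)))],
    ctx (var 0) (biimp (var 1) (conj (var 4) (var 5)))⟩
/-- `s ↔ k`, `k ↔ ⊥` give `¬s`. [cite: CookReckhow1979, §2 (sound rule)] -/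
def rNotS0 : FregeRule := ⟨[ctx (var 0) (biimp (var 1) (var 2)), ctx (var 0) (biimp (var 2) (const false))], ctx (var 0) (neg (var 1))⟩
/-- `¬s` gives `¬s ∨ w`. [cite: CookReckhow1979, §2 (sound rule)] -/
def rImpOfNeg : FregeRule := ⟨[ctx (var 0) (neg (var 1))], ctx (var 0) (disj (neg (var 1)) (var 2))⟩
/-- `s ↔ c ∧ x` gives `¬s ∨ x`. [cite: CookReckhow1979, §2 (sound rule)] -/
def rImpOfMask : FregeRule := ⟨[ctx (var 0) (biimp (var 1) (conj (var 2) (var 3)))], ctx (var 0) (disj (neg (var 1)) (var 3))⟩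
/-- `R ↔ mux(g, d, s)`, `¬g`, `s ↔ c ∧ x` give `R ↔ c ∧ x`. [cite: CookReckhow1979, §2 (sound rule)] -/
def rMuxFMask : FregeRule :=
  ⟨[ctx (var 0) (biimp (var 1) (muxF (var 2) (var 3) (var 4))), ctx (var 0) (neg (var 2)), ctx (var 0) (biimp (var 4) (conj (var 5) (var 6)))],
    ctx (var 0) (biimp (var 1) (conj (var 5) (var 6)))⟩
/-- `s ↔ m`, `m ↔ a ∧ c` give `s ↔ c ∧ a`. [cite: CookReckhow1979, §2 (sound rule)] -/
def rChainSwap : FregeRule :=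
  ⟨[ctx (var 0) (biimp (var 1) (var 2)), ctx (var 0) (biimp (var 2) (conj (var 3) (var 4)))], ctx (var 0) (biimp (var 1) (conj (var 4) (var 3)))⟩
/-- `s ↔ r`, `r ↔ c ∧ x` give `s ↔ c ∧ x`. [cite: CookReckhow1979, §2 (sound rule)] -/
def rChain2 : FregeRule :=
  ⟨[ctx (var 0) (biimp (var 1) (var 2)), ctx (var 0) (biimp (var 2) (conj (var 3) (var 4)))], ctx (var 0) (biimp (var 1) (conj (var 3) (var 4)))⟩
/-- `p ↔ c ∧ x`, `m ↔ c ∧ x` give `p ↔ m`. [cite: CookReckhow1979, §2 (sound rule)] -/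
def rMaskEqv : FregeRule :=
  ⟨[ctx (var 0) (biimp (var 1) (conj (var 3) (var 4))), ctx (var 0) (biimp (var 2) (conj (var 3) (var 4)))], ctx (var 0) (eqv 1 2)⟩
/-- `R ↔ mux(g, d, s)`, `¬g`, `¬s` give `¬R`. [cite: CookReckhow1979, §2 (sound rule)] -/
def rMuxFNot : FregeRule :=
  ⟨[ctx (var 0) (biimp (var 1) (muxF (var 2) (var 3) (var 4))), ctx (var 0) (neg (var 2)), ctx (var 0) (neg (var 4))], ctx (var 0) (neg (var 1))⟩
/-- `m ↔ b ∧ u`, `¬u` give `¬m` (`rAndF2` again, listed for self-containment). [cite: CookReckhow1979, §2 (sound rule)] -/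
def rAndFu : FregeRule := ⟨[ctx (var 0) (biimp (var 1) (conj (var 2) (var 3))), ctx (var 0) (neg (var 3))], ctx (var 0) (neg (var 1))⟩

/-- The rules of the unit law. [cite: CookReckhow1979, §2] -/
def rules : List FregeRule :=
  [rMaskFF, rChainMask, rNotS0, rImpOfNeg, rImpOfMask, rMuxFMask, rChainSwap, rChain2, rMaskEqv, rMuxFNot, rAndFu]

/-- Every rule of the unit law is sound (truth tables). [cite: CookReckhow1979, §2 (sound rule)] -/
theorem isSound_of_mem_rules : ∀ r ∈ rules, r.IsSound := by
  intro r hr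
  simp only [rules, List.mem_cons, List.not_mem_nil, or_false] at hr
  rcases hr with rfl | rfl | rfl | rfl | rfl | rfl | rfl | rfl | rfl | rfl | rfl <;> exact FregeRule.isSound_of_check (by decide +kernel)

/-- Inference by rule number `i`. [folklore] -/
theorem infer {G : FregeSystem} (hG : ∀ r ∈ rules, r ∈ G.rules) (i : ℕ) (hi : i < rules.length) {S : Set (PropForm ℕ)}
    (σ : ℕ → PropForm ℕ) {φ : PropForm ℕ} (hφ : (rules[i]).conclusion.subst σ = φ)
    (hp : ∀ ψ ∈ (rules[i]).premises, ψ.subst σ ∈ S) : G.IsInferredFrom S φ :=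
  hφ ▸ FregeSystem.IsInferredFrom.of_rule (hG _ (List.getElem_mem hi)) σ rfl hp

/-! ### The kit: a chain of shift kits -/

section Kit

variable (L : ℕ)

/-- The wiring of shift kit `s`: the word `a >> s`, the modulus, the zero gate. [folklore] -/
def wSh (s : ℕ) (i : ℕ) : ℕ ⊕ ℕ :=
  if i < L then (if i + s < L then Sum.inl (i + s) else Sum.inl (2 * L)) else Sum.inl i

/-- The pieces: shift kit `s` for `s < L`. [cite: Vollmer1999, §1.2] -/
def pieces (s : ℕ) : Piece := ⟨Shift.shiftT L, 2 * L + 1, wSh L s⟩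

/-- **The kit of the unit law.** [cite: Vollmer1999, §1.2–1.3] -/
def oneT : Template := layout (pieces L) L

/-- Length of a shift kit. [folklore] -/
theorem length_shiftT : (Shift.shiftT L).length = 4 * L + 2 := by
  simp [Shift.shiftT, length_layout, offset_succ, offset_zero, Shift.pieces, Shift.copyT]; ring

/-- Offsets of the pieces. [folklore] -/
theorem offset_pieces (k : ℕ) : offset (pieces L) k = k * (4 * L + 2) := by
  induction k with
  | zero => simp [offset_zero]
  | succ k ih => rw [offset_succ, ih]; simp [pieces, length_shiftT]; ring

/-- **The kit is well formed** (`2L + 1` inputs). [cite: Vollmer1999, Def. 1.6] -/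
theorem wf_oneT : (oneT L).WF (2 * L + 1) :=
  wf_layout (pieces L) fun k _ => ⟨Shift.wf_shiftT L, fun i hi => by
    unfold pieces at hi ⊢; unfold wSh; dsimp only at hi ⊢
    split_ifs <;> exact ⟨fun a ha => by cases ha; omega, fun g hg => by cases hg⟩⟩

variable (o : Occ)

/-- The shifted words `Aw s = a >> s` (zero gate above). [folklore] -/
def Aw (s : ℕ) (i : ℕ) : ℕ := if i + s < L then o.inp (i + s) else o.inp (2 * L)
/-- The modulus. [folklore] -/
def nw (i : ℕ) : ℕ := o.inp (L + i)
/-- The zero gate. [folklore] -/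
def zg : ℕ := o.inp (2 * L)
/-- The occurrence of shift kit `s`. [folklore] -/
def Sh (s : ℕ) : Occ := pieceOcc (o.inst (2 * L + 1)) (pieces L) s
/-- The comparator of `Aw (s + 1)`: the `H` of shift kit `s`. [folklore] -/
def CH (s : ℕ) : Sub.View := Shift.H L (Sh L o s)

end Kit

variable {L : ℕ} {o : Occ} {K : PropForm ℕ} {Γ : Set (PropForm ℕ)} {G : FregeSystem}

/-- The inputs of shift kit `s`. [folklore] -/
theorem Sh_inp {s i : ℕ} (hi2 : i < 2 * L + 1) : ((Sh L o s).inp i = if i < L then Aw L o s i else o.inp i) := by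
  rw [show Sh L o s = pieceOcc (o.inst (2 * L + 1)) (pieces L) s from rfl, inp_pieceOcc]
  show (o.inst (2 * L + 1)).ref (wSh L s i) = _
  unfold wSh Aw
  split_ifs <;> exact Occ.ref_inl o (by omega)

/-- The base of shift kit `s`. [folklore] -/
theorem Sh_base {s : ℕ} : (Sh L o s).base = o.base + s * (4 * L + 2) := by
  simp [Sh, pieceOcc, offset_pieces]

/-- Availability of the shift kits. [folklore] -/
theorem avail_Sh (ho : o.Avail (oneT L) (2 * L + 1) K Γ) {s : ℕ} (hs : s < L) :
    Shift.SAvail L (Sh L o s) K Γ :=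
  Shift.avail_ofOcc (Inst.DefsAvail.piece ho (k := s) hs (Shift.wf_shiftT L))

/-- The shifted word of kit `s` is `Aw (s + 1)`. [folklore] -/
theorem hv_Sh {s i : ℕ} (hi : i < L) : Shift.hv L (Sh L o s) i = Aw L o (s + 1) i := by
  unfold Shift.hv
  by_cases h1 : i + 1 < L
  · rw [if_pos h1, Sh_inp (by omega), if_pos h1]; unfold Aw; rw [show i + 1 + s = i + (s + 1) by omega]
  · rw [if_neg h1, Sh_inp (by omega), if_neg (show ¬2 * L < L by omega)]; unfold Aw; rw [if_neg (show ¬i + (s + 1) < L by omega)]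

/-- The word of kit `s` is `Aw s`. [folklore] -/
theorem bv_Sh {s i : ℕ} (hi : i < L) : Shift.bv (Sh L o s) i = Aw L o s i := by
  unfold Shift.bv; rw [Sh_inp (by omega), if_pos hi]

/-- The modulus of kit `s`. [folklore] -/
theorem nv_Sh {s i : ℕ} (hi : i < L) : Shift.nv L (Sh L o s) i = nw L o i := by
  unfold Shift.nv nw; rw [Sh_inp (by omega), if_neg (by omega)]

/-- The zero gate of kit `s`. [folklore] -/
theorem zv_Sh {s : ℕ} : Shift.zv L (Sh L o s) = zg L o := by
  unfold Shift.zv zg; rw [Sh_inp (by omega), if_neg (by omega)]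

/-- `Aw 0` is `a`. [folklore] -/
theorem Aw_zero {i : ℕ} (hi : i < L) : Aw L o 0 i = o.inp i := by unfold Aw; rw [if_pos (by omega)]; rfl

/-- `Aw L` is the zero word. [folklore] -/
theorem Aw_L {i : ℕ} : Aw L o L i = zg L o := by unfold Aw zg; rw [if_neg (by omega)]

/-- The shift relation: bit `i + 1` of `Aw s` is bit `i` of `Aw (s + 1)`. [folklore] -/
theorem Aw_succ {s i : ℕ} : Aw L o s (i + 1) = Aw L o (s + 1) i := by
  unfold Aw; simp only [show i + 1 + s = i + (s + 1) by omega]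

/-! ### The stage of the unit law -/

section Stage

variable (L : ℕ) (o : Occ) (K : PropForm ℕ) (V : View) (c bA : ℕ) (t : ℕ)

/-- The base of the comparator of `Aw s`: the consumer's (`s = 0`) or shift kit `s - 1`'s. [folklore] -/
def cab (s : ℕ) : ℕ := if s = 0 then bA else (Sh L o (s - 1)).base
/-- The comparator of `Aw s` with `n`. [folklore] -/
def CA (s : ℕ) : Sub.View := ⟨cab L o bA s, Aw L o s, nw L o⟩

/-- The adder of the doubling `D_t`. [folklore] -/
def S1 : Adder.View := (V.Dv L t).S
/-- The comparator of the doubling. [folklore] -/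
def D1 : Sub.View := (V.Dv L t).D L
/-- The adder of the accumulation `A_t`. [folklore] -/
def S2 : Adder.View := (V.Av L t).S
/-- The comparator of the accumulation. [folklore] -/
def D2 : Sub.View := (V.Av L t).D L
/-- The target word of stage `t`: `A_{t+1} = a >> (L - t - 1)`. [folklore] -/
def A' : ℕ → ℕ := Aw L o (L - t - 1)

/-- The segments of stage `t`. [folklore] -/
def segs : List (List (PropForm ℕ)) :=
  [(List.range L).map (fun i => ctx K (biimp (var ((S1 L V t).c (i + 1))) (var (V.P L t i)))),            -- 0 carries = P_t
   (List.range L).map (fun i => ctx K (biimp (var ((S1 L V t).s i)) (var ((S1 L V t).c i)))),             -- 1 sums = carries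
   [ctx K (neg (var ((S1 L V t).s 0)))],                                                                    -- 2
   (List.range (L - 1)).map (fun i => ctx K (biimp (var ((S1 L V t).s (i + 1))) (conj (var c) (var (A' L o t (i + 1)))))),  -- 3
   (List.range L).map (fun i => ctx K (disj (neg (var ((S1 L V t).s i))) (var (A' L o t i)))),             -- 4
   Shift.monoLines (CA L o bA (L - t - 1)) (D1 L V t) K L,                                                 -- 5 ¬ge(D_t)
   [ctx K (neg (var ((V.Dv L t).R L 0)))],                                                                  -- 6
   (List.range (L - 1)).map (fun i => ctx K (biimp (var ((V.Dv L t).R L (i + 1))) (conj (var c) (var (A' L o t (i + 1)))))),  -- 7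
   (List.range (L - 1)).map (fun i => ctx K (neg (var (V.msk L t (i + 1))))),                               -- 8
   (List.range L).map (fun i => ctx K (neg (conj (var ((S2 L V t).x i)) (var ((S2 L V t).y i))))),        -- 9
   Shift.dorLines (S2 L V t) K L,                                                                           -- 10
   [ctx K (biimp (var ((S2 L V t).s 0)) (var (V.msk L t 0)))],                                             -- 11
   (List.range (L - 1)).map (fun i => ctx K (biimp (var ((S2 L V t).s (i + 1))) (var ((V.Dv L t).R L (i + 1))))),   -- 12
   (List.range L).map (fun i => ctx K (biimp (var ((S2 L V t).s i)) (conj (var c) (var (A' L o t i))))),  -- 13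
   (List.range L).map (fun i => ctx K (disj (neg (var ((S2 L V t).s i))) (var (A' L o t i)))),             -- 14
   Shift.monoLines (CA L o bA (L - t - 1)) (D2 L V t) K L,                                                 -- 15 ¬ge(A_t)
   (List.range L).map (fun i => ctx K (biimp (var (V.P L (t + 1) i)) (conj (var c) (var (A' L o t i)))))] -- 16 IH(t+1)

end Stage

/-- The length of the segment list. [folklore] -/
theorem length_segs (L : ℕ) (o : Occ) (K : PropForm ℕ) (V : View) (c bA t : ℕ) : (segs L o K V c bA t).length = 17 := rfl

/-- Bit `0` of `Aw s`. [folklore] -/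
theorem Aw_zero_idx {s : ℕ} (hs : s < L) : Aw L o s 0 = o.inp s := by unfold Aw; rw [if_pos (by omega), Nat.zero_add]

/-- **Stage `t` of the unit law**: from `P_t ≡ c ∧ A_t` (lines) derive `P_{t+1} ≡ c ∧ A_{t+1}`.
[cite: CookReckhow1979, §2] -/
theorem isBlock_segs (hGO : ∀ r ∈ rules, r ∈ G.rules) (hGS : ∀ r ∈ Sys.glue, r ∈ G.rules) (hGY : ∀ r ∈ Sys.sysRules, r ∈ G.rules)
    {V : View} {c bA : ℕ} {T : Set (PropForm ℕ)} (hV : V.Avail L K T) {t : ℕ} (ht : t < L)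
    (hVa0 : V.a 0 = c) (hVas : ∀ i, 1 ≤ i → i < L → V.a i = zg L o) (hVb : ∀ j < L, V.b j = o.inp j)
    (hVn : ∀ i < L, V.n i = nw L o i) (hz : ctx K (neg (var (zg L o))) ∈ T)
    (hCA : (CA L o bA (L - t - 1)).Avail K T L) (hlt : ctx K (neg (var ((CA L o bA (L - t - 1)).ge L L))) ∈ T)
    (hIH : ∀ i < L, ctx K (biimp (var (V.P L t i)) (conj (var c) (var (Aw L o (L - t) i)))) ∈ T) :
    G.IsBlock T (segs L o K V c bA t).flatten := by
  have hL : 0 < L := by omega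
  have eA : ∀ i, Aw L o (L - t) i = A' L o t (i + 1) := fun i => by
    unfold A'; rw [Aw_succ, show L - t - 1 + 1 = L - t by omega]
  have hS1 : (S1 L V t).Avail K T false L := (hV.hD t ht).1
  have hD1 : (D1 L V t).Avail K T L := (hV.hD t ht).2.1
  have hS2 : (S2 L V t).Avail K T false L := (hV.hA t ht).1
  have hD2 : (D2 L V t).Avail K T L := (hV.hA t ht).2.1
  refine ModAddU.AssocData.isBlock_flatten _ fun k hk => ?_
  rw [length_segs] at hk
  have mem : ∀ {χ} (j : ℕ) (hj : j < k) (hχ : χ ∈ (segs L o K V c bA t)[j]'(by rw [length_segs]; omega)),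
      χ ∈ T ∪ {χ | ∃ j, ∃ hj : j < k, χ ∈ (segs L o K V c bA t)[j]'(by rw [length_segs]; omega)} :=
    fun j hj hχ => Or.inr ⟨j, hj, hχ⟩
  have hΓ : T ⊆ T ∪ {χ | ∃ j, ∃ hj : j < k, χ ∈ (segs L o K V c bA t)[j]'(by rw [length_segs]; omega)} := fun _ hχ => Or.inl hχ
  have mr : ∀ {f : ℕ → PropForm ℕ} {W i : ℕ}, i < W → f i ∈ (List.range W).map f := fun hi => List.mem_map.2 ⟨_, List.mem_range.2 hi, rfl⟩
  interval_cases k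
  · -- 0: `κ_{i+1} ↔ P_t i` (doubling, carries)
    refine Scaffold.isBlock_of_forall fun θ hθ => ?_
    obtain ⟨i, hi, rfl⟩ := List.mem_map.1 hθ
    rw [List.mem_range] at hi
    refine Or.inr (Sys.glue_infer hGS 1 (by decide) (FregeSystem.sub [K, var ((S1 L V t).c (i + 1)), var (V.P L t i), var ((S1 L V t).c i)])
      rfl fun ψ hψ => ?_)
    simp only [Sys.glue, List.getElem_cons_succ, List.getElem_cons_zero, Sys.rDblC, List.mem_singleton] at hψ
    subst hψ; exact hΓ (hS1.2 i hi).2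
  · -- 1: `s_i ↔ κ_i` (doubling, sums)
    refine Scaffold.isBlock_of_forall fun θ hθ => ?_
    obtain ⟨i, hi, rfl⟩ := List.mem_map.1 hθ
    rw [List.mem_range] at hi
    refine Or.inr (Sys.glue_infer hGS 0 (by decide) (FregeSystem.sub [K, var ((S1 L V t).s i), var (V.P L t i), var ((S1 L V t).c i)])
      rfl fun ψ hψ => ?_)
    simp only [Sys.glue, List.getElem_cons_zero, Sys.rDblS, List.mem_singleton] at hψ
    subst hψ; exact hΓ (hS1.2 i hi).1
  · -- 2: `¬s_0`
    refine FregeSystem.IsBlock.singleton (Or.inr (infer hGO 2 (by decide) (FregeSystem.sub [K, var ((S1 L V t).s 0), var ((S1 L V t).c 0)])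
      rfl fun ψ hψ => ?_))
    simp only [rules, List.getElem_cons_succ, List.getElem_cons_zero, rNotS0, List.mem_cons, List.not_mem_nil, or_false] at hψ
    rcases hψ with rfl | rfl
    · exact mem 1 (by omega) (mr hL)
    · exact hΓ hS1.1
  · -- 3: `s_{i+1} ↔ c ∧ A' (i+1)`
    refine Scaffold.isBlock_of_forall fun θ hθ => ?_
    obtain ⟨i, hi, rfl⟩ := List.mem_map.1 hθ
    rw [List.mem_range] at hi
    refine Or.inr (infer hGO 1 (by decide) (FregeSystem.sub [K, var ((S1 L V t).s (i + 1)), var ((S1 L V t).c (i + 1)),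
      var (V.P L t i), var c, var (A' L o t (i + 1))]) rfl fun ψ hψ => ?_)
    simp only [rules, List.getElem_cons_succ, List.getElem_cons_zero, rChainMask, List.mem_cons, List.not_mem_nil, or_false] at hψ
    rcases hψ with rfl | rfl | rfl
    · exact mem 1 (by omega) (mr (by omega))
    · exact mem 0 (by omega) (mr (by omega))
    · rw [← eA]; exact hΓ (hIH i (by omega))
  · -- 4: domination premises for the sum word of `D_t`
    refine Scaffold.isBlock_of_forall fun θ hθ => ?_
    obtain ⟨i, hi, rfl⟩ := List.mem_map.1 hθ
    rw [List.mem_range] at hi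
    rcases Nat.eq_zero_or_pos i with rfl | hi0
    · refine Or.inr (infer hGO 3 (by decide) (FregeSystem.sub [K, var ((S1 L V t).s 0), var (A' L o t 0)]) rfl fun ψ hψ => ?_)
      simp only [rules, List.getElem_cons_succ, List.getElem_cons_zero, rImpOfNeg, List.mem_singleton] at hψ
      subst hψ; exact mem 2 (by omega) (List.mem_singleton_self _)
    · obtain ⟨j, rfl⟩ : ∃ j, i = j + 1 := ⟨i - 1, by omega⟩
      refine Or.inr (infer hGO 4 (by decide) (FregeSystem.sub [K, var ((S1 L V t).s (j + 1)), var c, var (A' L o t (j + 1))]) rfl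
        fun ψ hψ => ?_)
      simp only [rules, List.getElem_cons_succ, List.getElem_cons_zero, rImpOfMask, List.mem_singleton] at hψ
      subst hψ; exact mem 3 (by omega) (mr (by omega))
  · -- 5: `¬ge(D_t)` by domination
    exact Shift.isBlock_monoLines hGY (hCA.mono hΓ) (hD1.mono hΓ) (fun i hi => hVn i hi) (fun i hi => mem 4 (by omega) (mr hi)) (hΓ hlt)
  · -- 6: `¬R(D_t) 0`
    refine FregeSystem.IsBlock.singleton (Or.inr (infer hGO 9 (by decide) (FregeSystem.sub [K, var ((V.Dv L t).R L 0), var ((V.Dv L t).ge L),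
      var ((V.Dv L t).d L 0), var ((S1 L V t).s 0)]) rfl fun ψ hψ => ?_))
    simp only [rules, List.getElem_cons_succ, List.getElem_cons_zero, rMuxFNot, List.mem_cons, List.not_mem_nil, or_false] at hψ
    rcases hψ with rfl | rfl | rfl
    · exact hΓ ((hV.hD t ht).2.2 0 hL)
    · exact mem 5 (by omega) (Shift.mem_monoLines _ _ _ _)
    · exact mem 2 (by omega) (List.mem_singleton_self _)
  · -- 7: `R(D_t) (i+1) ↔ c ∧ A' (i+1)`
    refine Scaffold.isBlock_of_forall fun θ hθ => ?_
    obtain ⟨i, hi, rfl⟩ := List.mem_map.1 hθ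
    rw [List.mem_range] at hi
    refine Or.inr (infer hGO 5 (by decide) (FregeSystem.sub [K, var ((V.Dv L t).R L (i + 1)), var ((V.Dv L t).ge L),
      var ((V.Dv L t).d L (i + 1)), var ((S1 L V t).s (i + 1)), var c, var (A' L o t (i + 1))]) rfl fun ψ hψ => ?_)
    simp only [rules, List.getElem_cons_succ, List.getElem_cons_zero, rMuxFMask, List.mem_cons, List.not_mem_nil, or_false] at hψ
    rcases hψ with rfl | rfl | rfl
    · exact hΓ ((hV.hD t ht).2.2 (i + 1) (by omega))
    · exact mem 5 (by omega) (Shift.mem_monoLines _ _ _ _)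
    · exact mem 3 (by omega) (mr hi)
  · -- 8: `¬mk (i+1)` (the multiplicand is zero above bit 0)
    refine Scaffold.isBlock_of_forall fun θ hθ => ?_
    obtain ⟨i, hi, rfl⟩ := List.mem_map.1 hθ
    rw [List.mem_range] at hi
    refine Or.inr (infer hGO 10 (by decide) (FregeSystem.sub [K, var (V.msk L t (i + 1)), var (V.b (L - 1 - t)), var (zg L o)]) rfl
      fun ψ hψ => ?_)
    simp only [rules, List.getElem_cons_succ, List.getElem_cons_zero, rAndFu, List.mem_cons, List.not_mem_nil, or_false] at hψ
    rcases hψ with rfl | rfl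
    · have := hV.hmk t ht (i + 1) (by omega)
      rw [View.mkDef, hVas (i + 1) (by omega) (by omega)] at this
      exact hΓ this
    · exact hΓ hz
  · -- 9: disjointness of `R(D_t)` and `mk`
    refine Scaffold.isBlock_of_forall fun θ hθ => ?_
    obtain ⟨i, hi, rfl⟩ := List.mem_map.1 hθ
    rw [List.mem_range] at hi
    rcases Nat.eq_zero_or_pos i with rfl | hi0
    · refine Or.inr (Sys.glue_infer hGS 3 (by decide) (FregeSystem.sub [K, var ((V.Dv L t).R L 0), var (V.msk L t 0)]) rfl
        fun ψ hψ => ?_)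
      simp only [Sys.glue, List.getElem_cons_succ, List.getElem_cons_zero, Sys.rNAndL, List.mem_singleton] at hψ
      subst hψ; exact mem 6 (by omega) (List.mem_singleton_self _)
    · obtain ⟨j, rfl⟩ : ∃ j, i = j + 1 := ⟨i - 1, by omega⟩
      refine Or.inr (Sys.glue_infer hGS 4 (by decide) (FregeSystem.sub [K, var ((V.Dv L t).R L (j + 1)), var (V.msk L t (j + 1))]) rfl
        fun ψ hψ => ?_)
      simp only [Sys.glue, List.getElem_cons_succ, List.getElem_cons_zero, Sys.rNAndR, List.mem_singleton] at hψ
      subst hψ; exact mem 8 (by omega) (mr (by omega))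
  · -- 10: the disjoint sum `s'_i ↔ R_i ∨ mk_i`
    exact Shift.isBlock_dorLines hGY (hS2.mono hΓ) fun i hi => mem 9 (by omega) (mr hi)
  · -- 11: `s'_0 ↔ mk_0`
    refine FregeSystem.IsBlock.singleton (Or.inr (Sys.glue_infer hGS 6 (by decide)
      (FregeSystem.sub [K, var ((S2 L V t).s 0), var ((V.Dv L t).R L 0), var (V.msk L t 0)]) rfl fun ψ hψ => ?_))
    simp only [Sys.glue, List.getElem_cons_succ, List.getElem_cons_zero, Sys.rOrFL, List.mem_cons, List.not_mem_nil, or_false] at hψ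
    rcases hψ with rfl | rfl
    · exact mem 10 (by omega) (Shift.mem_dorLines hL)
    · exact mem 6 (by omega) (List.mem_singleton_self _)
  · -- 12: `s'_{i+1} ↔ R_{i+1}`
    refine Scaffold.isBlock_of_forall fun θ hθ => ?_
    obtain ⟨i, hi, rfl⟩ := List.mem_map.1 hθ
    rw [List.mem_range] at hi
    refine Or.inr (Sys.glue_infer hGS 5 (by decide)
      (FregeSystem.sub [K, var ((S2 L V t).s (i + 1)), var ((V.Dv L t).R L (i + 1)), var (V.msk L t (i + 1))]) rfl fun ψ hψ => ?_)
    simp only [Sys.glue, List.getElem_cons_succ, List.getElem_cons_zero, Sys.rOrFR, List.mem_cons, List.not_mem_nil, or_false] at hψ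
    rcases hψ with rfl | rfl
    · exact mem 10 (by omega) (Shift.mem_dorLines (by omega))
    · exact mem 8 (by omega) (mr hi)
  · -- 13: `s'_i ↔ c ∧ A' i`
    refine Scaffold.isBlock_of_forall fun θ hθ => ?_
    obtain ⟨i, hi, rfl⟩ := List.mem_map.1 hθ
    rw [List.mem_range] at hi
    rcases Nat.eq_zero_or_pos i with rfl | hi0
    · refine Or.inr (infer hGO 6 (by decide) (FregeSystem.sub [K, var ((S2 L V t).s 0), var (V.msk L t 0), var (A' L o t 0), var c])
        rfl fun ψ hψ => ?_)
      simp only [rules, List.getElem_cons_succ, List.getElem_cons_zero, rChainSwap, List.mem_cons, List.not_mem_nil, or_false] at hψ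
      rcases hψ with rfl | rfl
      · exact mem 11 (by omega) (List.mem_singleton_self _)
      · have := hV.hmk t ht 0 hL
        rw [View.mkDef, hVa0, hVb _ (by omega)] at this
        show ctx K (biimp (var (V.msk L t 0)) (conj (var (A' L o t 0)) (var c))) ∈ _
        rw [show A' L o t 0 = o.inp (L - 1 - t) from by unfold A'; rw [Aw_zero_idx (by omega)]; congr 1; omega]
        exact hΓ this
    · obtain ⟨j, rfl⟩ : ∃ j, i = j + 1 := ⟨i - 1, by omega⟩
      refine Or.inr (infer hGO 7 (by decide) (FregeSystem.sub [K, var ((S2 L V t).s (j + 1)), var ((V.Dv L t).R L (j + 1)), var c,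
        var (A' L o t (j + 1))]) rfl fun ψ hψ => ?_)
      simp only [rules, List.getElem_cons_succ, List.getElem_cons_zero, rChain2, List.mem_cons, List.not_mem_nil, or_false] at hψ
      rcases hψ with rfl | rfl
      · exact mem 12 (by omega) (mr (by omega))
      · exact mem 7 (by omega) (mr (by omega))
  · -- 14: domination premises for the sum word of `A_t`
    refine Scaffold.isBlock_of_forall fun θ hθ => ?_
    obtain ⟨i, hi, rfl⟩ := List.mem_map.1 hθ
    rw [List.mem_range] at hi
    refine Or.inr (infer hGO 4 (by decide) (FregeSystem.sub [K, var ((S2 L V t).s i), var c, var (A' L o t i)]) rfl fun ψ hψ => ?_)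
    simp only [rules, List.getElem_cons_succ, List.getElem_cons_zero, rImpOfMask, List.mem_singleton] at hψ
    subst hψ; exact mem 13 (by omega) (mr hi)
  · -- 15: `¬ge(A_t)` by domination
    exact Shift.isBlock_monoLines hGY (hCA.mono hΓ) (hD2.mono hΓ) (fun i hi => hVn i hi) (fun i hi => mem 14 (by omega) (mr hi)) (hΓ hlt)
  · -- 16: `P_{t+1} i ↔ c ∧ A' i`
    refine Scaffold.isBlock_of_forall fun θ hθ => ?_
    obtain ⟨i, hi, rfl⟩ := List.mem_map.1 hθ
    rw [List.mem_range] at hi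
    refine Or.inr (infer hGO 5 (by decide) (FregeSystem.sub [K, var (V.P L (t + 1) i), var ((V.Av L t).ge L),
      var ((V.Av L t).d L i), var ((S2 L V t).s i), var c, var (A' L o t i)]) ?_ fun ψ hψ => ?_)
    · rfl
    · simp only [rules, List.getElem_cons_succ, List.getElem_cons_zero, rMuxFMask, List.mem_cons, List.not_mem_nil, or_false] at hψ
      rcases hψ with rfl | rfl | rfl
      · rw [View.P_succ]; exact hΓ ((hV.hA t ht).2.2 i hi)
      · exact mem 15 (by omega) (Shift.mem_monoLines _ _ _ _)
      · exact mem 13 (by omega) (mr hi)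

/-! ### The whole law -/

section Whole

variable (L : ℕ) (o : Occ) (K : PropForm ℕ) (V : View) (c bA : ℕ)

/-- The shift blocks of kits `0 … s-1`: the facts `Aw 1 < n, …, Aw s < n`. [folklore] -/
def shUpTo : ℕ → List (PropForm ℕ)
  | 0 => []
  | s + 1 => shUpTo s ++ Shift.lines K L (Sh L o s) (cab L o bA s)

/-- The constant facts and the base `P_0 ≡ c ∧ Aw L` (both sides false). [folklore] -/
def baseLines : List (PropForm ℕ) :=
  [ctx K (neg (var V.z)), ctx K (neg (var (zg L o)))] ++
    (List.range L).map fun i => ctx K (biimp (var (V.P L 0 i)) (conj (var c) (var (Aw L o L i))))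

/-- The stages below `t`. [folklore] -/
def oneUpTo : ℕ → List (PropForm ℕ)
  | 0 => baseLines L o K V c
  | t + 1 => oneUpTo t ++ (segs L o K V c bA t).flatten

/-- **The lines of the unit law.** [folklore] -/
def lines : List (PropForm ℕ) := shUpTo L o K bA L ++ oneUpTo L o K V c bA L

end Whole

/-- The facts of the shift chain: `¬ge` of the comparator of `Aw s`, for `1 ≤ s ≤ t`. [folklore] -/
theorem mem_shUpTo {bA s t : ℕ} (hs : s < t) :
    ctx K (neg (var ((CA L o bA (s + 1)).ge L L))) ∈ shUpTo L o K bA t := by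
  induction hs with
  | refl => exact List.mem_append_right _ Shift.mem_lines
  | step _ ih => exact List.mem_append_left _ ih

/-- Availability of the comparator of `Aw (s + 1)` (the `H` of shift kit `s`). [folklore] -/
theorem avail_CA_succ (ho : o.Avail (oneT L) (2 * L + 1) K Γ) {bA s : ℕ} (hs : s < L) : (CA L o bA (s + 1)).Avail K Γ L :=
  Sub.View.Avail.congr (avail_Sh ho hs).hH rfl (fun _ hi => (hv_Sh hi).symm) (fun _ hi => (nv_Sh hi).symm)

/-- **The shift chain forms a block.** [cite: CookReckhow1979, §2] -/
theorem isBlock_shUpTo (hGY : ∀ r ∈ Sys.sysRules, r ∈ G.rules) (hGS : ∀ r ∈ Sys.glue, r ∈ G.rules)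
    (ho : o.Avail (oneT L) (2 * L + 1) K Γ) {bA : ℕ} (hA0 : (CA L o bA 0).Avail K Γ L)
    (hlt0 : ctx K (neg (var ((CA L o bA 0).ge L L))) ∈ Γ) (hz0 : ctx K (biimp (var (zg L o)) (const false)) ∈ Γ) (hL : 0 < L) :
    ∀ t ≤ L, G.IsBlock Γ (shUpTo L o K bA t) := by
  intro t ht
  induction t with
  | zero => exact FregeSystem.IsBlock.nil _ _
  | succ s ih =>
    have hs : s < L := by omega
    refine (ih (by omega)).append (Shift.isBlock_lines hGY hGS ((avail_Sh ho hs).mono Set.subset_union_left) ?_ ?_ ?_ hL)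
    · have hCA : (CA L o bA s).Avail K Γ L := by
        rcases Nat.eq_zero_or_pos s with rfl | hs0
        · exact hA0
        · obtain ⟨k, rfl⟩ : ∃ k, s = k + 1 := ⟨s - 1, by omega⟩
          exact avail_CA_succ ho (by omega)
      exact (Sub.View.Avail.congr hCA rfl (fun i hi => bv_Sh hi) (fun i hi => nv_Sh hi) :
        (Shift.B L (Sh L o s) (cab L o bA s)).Avail K Γ L).mono Set.subset_union_left
    · rw [zv_Sh]; exact Or.inl hz0
    · rcases Nat.eq_zero_or_pos s with rfl | hs0
      · exact Or.inl hlt0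
      · obtain ⟨k, rfl⟩ : ∃ k, s = k + 1 := ⟨s - 1, by omega⟩
        exact Or.inr (mem_shUpTo (by omega))

/-- `P_t ≡ c ∧ Aw (L - t)` is among the lines up to `t`. [folklore] -/
theorem mem_oneUpTo {V : View} {c bA : ℕ} : ∀ {t i : ℕ}, i < L →
    ctx K (biimp (var (V.P L t i)) (conj (var c) (var (Aw L o (L - t) i)))) ∈ oneUpTo L o K V c bA t
  | 0, _, hi => List.mem_append_right _ (List.mem_map.2 ⟨_, List.mem_range.2 hi, rfl⟩)
  | t + 1, i, hi => by
    have h17 : (segs L o K V c bA t).length = 17 := rfl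
    exact List.mem_append_right _ (List.mem_flatten.2 ⟨_, List.getElem_mem (n := 16) (by omega),
      List.mem_map.2 ⟨i, List.mem_range.2 hi, rfl⟩⟩)

/-- `oneUpTo` is monotone. [folklore] -/
theorem oneUpTo_mono {V : View} {c bA s t : ℕ} (hst : s ≤ t) : ∀ χ ∈ oneUpTo L o K V c bA s, χ ∈ oneUpTo L o K V c bA t := by
  induction hst with
  | refl => exact fun χ h => h
  | step _ ih => exact fun χ h => List.mem_append_left _ (ih χ h)

/-- **The stages form a block.** [cite: CookReckhow1979, §2] -/
theorem isBlock_oneUpTo (hGO : ∀ r ∈ rules, r ∈ G.rules) (hGS : ∀ r ∈ Sys.glue, r ∈ G.rules)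
    (hGY : ∀ r ∈ Sys.sysRules, r ∈ G.rules) (hGL : ∀ r ∈ Logic.rules, r ∈ G.rules) {V : View} {c bA : ℕ} {T : Set (PropForm ℕ)}
    (hV : V.Avail L K T) (hVa0 : V.a 0 = c) (hVas : ∀ i, 1 ≤ i → i < L → V.a i = zg L o) (hVb : ∀ j < L, V.b j = o.inp j)
    (hVn : ∀ i < L, V.n i = nw L o i) (hz0 : ctx K (biimp (var (zg L o)) (const false)) ∈ T)
    (hCA : ∀ s ≤ L, (CA L o bA s).Avail K T L) (hlt : ∀ s ≤ L, ctx K (neg (var ((CA L o bA s).ge L L))) ∈ T) :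
    ∀ t ≤ L, G.IsBlock T (oneUpTo L o K V c bA t) := by
  intro t ht
  induction t with
  | zero =>
    refine (Scaffold.isBlock_of_forall fun θ hθ => ?_).append (Scaffold.isBlock_of_forall fun θ hθ => ?_)
    · simp only [List.mem_cons, List.not_mem_nil, or_false] at hθ
      rcases hθ with rfl | rfl
      · exact Or.inr (Logic.infer hGL 11 (by decide) (FregeSystem.sub [K, var V.z]) rfl (FregeSystem.prems_cons hV.hz FregeSystem.prems_nil))
      · exact Or.inr (Logic.infer hGL 11 (by decide) (FregeSystem.sub [K, var (zg L o)]) rfl (FregeSystem.prems_cons hz0 FregeSystem.prems_nil))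
    · obtain ⟨i, hi, rfl⟩ := List.mem_map.1 hθ
      refine Or.inr (infer hGO 0 (by decide) (FregeSystem.sub [K, var (V.P L 0 i), var c, var (Aw L o L i)]) rfl fun ψ hψ => ?_)
      simp only [rules, List.getElem_cons_zero, rMaskFF, List.mem_cons, List.not_mem_nil, or_false] at hψ
      rcases hψ with rfl | rfl
      · exact Or.inr List.mem_cons_self
      · rw [Aw_L]; exact Or.inr (List.mem_cons_of_mem _ List.mem_cons_self)
  | succ t ih =>
    refine (ih (by omega)).append (isBlock_segs hGO hGS hGY (hV.mono Set.subset_union_left) (by omega) hVa0 hVas hVb hVn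
      (Or.inr (oneUpTo_mono (Nat.zero_le t) _ ?_)) ((hCA _ (by omega)).mono Set.subset_union_left) (Or.inl (hlt _ (by omega)))
      fun i hi => Or.inr (mem_oneUpTo hi))
    exact List.mem_append_left _ (by simp)

/-- **The unit law of modular multiplication inside Frege**: for an available occurrence of
the kit on `(a, n, z)`, an available multiplier `V` with multiplicand the one-hot word
`(c, z, …, z)`, multiplier `a` and modulus `n`, the zero gate `z`, and the consumer's comparator
`(a, n)` available with `a < n`, the lines form a block concluding `P_L(V) ≡ c ∧ a` bitwise —
for `c` true, `1 ⊗ a = a`. [cite: CookReckhow1979, §2; Krajicek1995, §9.2] -/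
theorem isBlock_lines (hGO : ∀ r ∈ rules, r ∈ G.rules) (hGS : ∀ r ∈ Sys.glue, r ∈ G.rules)
    (hGY : ∀ r ∈ Sys.sysRules, r ∈ G.rules) (hGL : ∀ r ∈ Logic.rules, r ∈ G.rules)
    (ho : o.Avail (oneT L) (2 * L + 1) K Γ) {V : View} {c bA : ℕ} (hV : V.Avail L K Γ) (hVa0 : V.a 0 = c)
    (hVas : ∀ i, 1 ≤ i → i < L → V.a i = zg L o) (hVb : ∀ j < L, V.b j = o.inp j) (hVn : ∀ i < L, V.n i = nw L o i)
    (hz0 : ctx K (biimp (var (zg L o)) (const false)) ∈ Γ) (hA0 : (CA L o bA 0).Avail K Γ L)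
    (hlt0 : ctx K (neg (var ((CA L o bA 0).ge L L))) ∈ Γ) (hL : 0 < L) : G.IsBlock Γ (lines L o K V c bA) := by
  refine (isBlock_shUpTo hGY hGS ho hA0 hlt0 hz0 hL L le_rfl).append (isBlock_oneUpTo hGO hGS hGY hGL
    (hV.mono Set.subset_union_left) hVa0 hVas hVb hVn (Or.inl hz0) (fun s hs => ?_) (fun s hs => ?_) L le_rfl)
  · rcases Nat.eq_zero_or_pos s with rfl | hs0
    · exact hA0.mono Set.subset_union_left
    · obtain ⟨k, rfl⟩ : ∃ k, s = k + 1 := ⟨s - 1, by omega⟩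
      exact (avail_CA_succ ho (by omega)).mono Set.subset_union_left
  · rcases Nat.eq_zero_or_pos s with rfl | hs0
    · exact Or.inl hlt0
    · obtain ⟨k, rfl⟩ : ∃ k, s = k + 1 := ⟨s - 1, by omega⟩
      exact Or.inr (mem_shUpTo (by omega))

/-- **The conclusion of the unit law**: `P_L(V)ᵢ ↔ c ∧ aᵢ` for `i < L`. [folklore] -/
theorem mem_lines {V : View} {c bA i : ℕ} (hi : i < L) :
    ctx K (biimp (var (V.P L L i)) (conj (var c) (var (o.inp i)))) ∈ lines L o K V c bA := by
  have e : Aw L o (L - L) i = o.inp i := by rw [Nat.sub_self]; exact Aw_zero hi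
  rw [← e]; exact List.mem_append_right _ (mem_oneUpTo hi)

/-! ### The size of the law -/

/-- **Every line of a stage has size `≤ |K| + 40`.** [folklore] -/
theorem bounded_segs (L : ℕ) (o : Occ) (K : PropForm ℕ) (V : View) (c bA t : ℕ) :
    ModAddU.Bounded (K.size + 40) (segs L o K V c bA t).flatten := by
  have hM : Sys.MONO.inv.size ≤ 36 := by decide +kernel
  have hD : Sys.DOR.inv.size ≤ 8 := by decide +kernel
  refine ModAddU.Bounded.flatten fun D hD' => ?_
  simp only [segs, List.mem_cons, List.not_mem_nil, or_false] at hD'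
  rcases hD' with rfl | rfl | rfl | rfl | rfl | rfl | rfl | rfl | rfl | rfl | rfl | rfl | rfl | rfl | rfl | rfl | rfl
  · exact ModAddU.Bounded.map fun i _ => by rw [ModAddU.size_ctx, FregeSystem.size_biimp]; simp [size]
  · exact ModAddU.Bounded.map fun i _ => by rw [ModAddU.size_ctx, FregeSystem.size_biimp]; simp [size]
  · exact ModAddU.Bounded.singleton (by rw [ModAddU.size_ctx]; simp [size])
  · exact ModAddU.Bounded.map fun i _ => by rw [ModAddU.size_ctx, FregeSystem.size_biimp]; simp [size]
  · exact ModAddU.Bounded.map fun i _ => by rw [ModAddU.size_ctx]; simp [size]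
  · exact (ModAddU.bounded_sysLines (B := K.size + 40) _ _ _ _ (by omega)).append
      (ModAddU.Bounded.singleton (by rw [ModAddU.size_ctx, ModAddU.size_inst]; simp [size]))
  · exact ModAddU.Bounded.singleton (by rw [ModAddU.size_ctx]; simp [size])
  · exact ModAddU.Bounded.map fun i _ => by rw [ModAddU.size_ctx, FregeSystem.size_biimp]; simp [size]
  · exact ModAddU.Bounded.map fun i _ => by rw [ModAddU.size_ctx]; simp [size]
  · exact ModAddU.Bounded.map fun i _ => by rw [ModAddU.size_ctx]; simp [size]
  · exact (ModAddU.bounded_sysLines (B := K.size + 40) _ _ _ _ (by omega)).append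
      (ModAddU.Bounded.map fun i _ => by rw [ModAddU.size_ctx, ModAddU.size_inst]; simp [size, FregeSystem.size_biimp])
  · exact ModAddU.Bounded.singleton (by rw [ModAddU.size_ctx, FregeSystem.size_biimp]; simp [size])
  · exact ModAddU.Bounded.map fun i _ => by rw [ModAddU.size_ctx, FregeSystem.size_biimp]; simp [size]
  · exact ModAddU.Bounded.map fun i _ => by rw [ModAddU.size_ctx, FregeSystem.size_biimp]; simp [size]
  · exact ModAddU.Bounded.map fun i _ => by rw [ModAddU.size_ctx]; simp [size]
  · exact (ModAddU.bounded_sysLines (B := K.size + 40) _ _ _ _ (by omega)).append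
      (ModAddU.Bounded.singleton (by rw [ModAddU.size_ctx, ModAddU.size_inst]; simp [size]))
  · exact ModAddU.Bounded.map fun i _ => by rw [ModAddU.size_ctx, FregeSystem.size_biimp]; simp [size]

/-- A stage has at most `15L + 4` lines. [folklore] -/
theorem length_segs_flatten (L : ℕ) (o : Occ) (K : PropForm ℕ) (V : View) (c bA t : ℕ) (hL : 0 < L) :
    (segs L o K V c bA t).flatten.length = 15 * L + 4 := by
  simp only [segs, List.flatten_cons, List.flatten_nil, List.length_append, List.length_map, List.length_range,
    List.length_cons, List.length_nil, List.append_nil, Shift.monoLines, Shift.dorLines, System.lines]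
  omega

/-- **Size of the unit law**: `≤ (18L² + 8L + 2)(|K| + 100)`. [folklore] -/
theorem proofSize_lines (o : Occ) (K : PropForm ℕ) (V : View) (c bA : ℕ) (hL : 0 < L) :
    proofSize (lines L o K V c bA) ≤ (18 * L * L + 8 * L + 2) * (K.size + 100) := by
  have h1 : ∀ t, proofSize (shUpTo L o K bA t) ≤ t * ((3 * L + 3) * (K.size + 100)) := by
    intro t
    induction t with
    | zero => simp [shUpTo]
    | succ t ih =>
      rw [shUpTo, proofSize_append]
      calc _ ≤ t * ((3 * L + 3) * (K.size + 100)) + (3 * L + 3) * (K.size + 100) := Nat.add_le_add ih (Shift.proofSize_lines _)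
        _ = _ := by ring
  have h2 : ∀ t, proofSize (oneUpTo L o K V c bA t) ≤ (L + 2) * (K.size + 20) + t * ((15 * L + 4) * (K.size + 40)) := by
    intro t
    induction t with
    | zero =>
      rw [oneUpTo, Nat.zero_mul, Nat.add_zero]
      refine (ModAddU.Bounded.proofSize_le (B := K.size + 20) fun θ hθ => ?_).trans (by simp [baseLines])
      simp only [baseLines, List.mem_append, List.mem_cons, List.not_mem_nil, or_false, List.mem_map] at hθ
      rcases hθ with (rfl | rfl) | ⟨i, -, rfl⟩
      · rw [ModAddU.size_ctx]; simp [size]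
      · rw [ModAddU.size_ctx]; simp [size]
      · rw [ModAddU.size_ctx, FregeSystem.size_biimp]; simp [size]
    | succ t ih =>
      rw [oneUpTo, proofSize_append]
      have h3 := (bounded_segs L o K V c bA t).proofSize_le
      rw [length_segs_flatten L o K V c bA t hL] at h3
      calc _ ≤ (L + 2) * (K.size + 20) + t * ((15 * L + 4) * (K.size + 40)) + (15 * L + 4) * (K.size + 40) := Nat.add_le_add ih h3
        _ = _ := by ring
  rw [lines, proofSize_append]
  nlinarith [h1 L, h2 L, Nat.zero_le K.size]

end One

end ModMulU

end Literature.Computability.MetaComplexity
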